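import Summits.ResolutionOfSingularities.ResolutionOfSingularities.Theorems.EquisingularLiftEquisingularLiftNatRatLiftAlgebra
import Mathlib
import HarnessLib

/-!
# [OURS · L1 W4.5(b) · EL♮(3)] T-RATLIFT-ALG, PART 2 — REDUCTION: the «exact trace» of the lifted parametrisation kernel,
# `(𝔓.map π)_m = 𝔭_m` in every degree where the downstairs cofinite clause holds (Nakayama), and its saturation /
# localisation consequences
# (crux `EquisingularLiftNatThree` = stmt-ResolutionOfSingularities-20148, parent stmt-20038, line `sections`;
# res-L1-w45b-plan-1 PLANNER-MEMO-g10-1 §2 cut 1 / object O1 «RatLift»; part 1 = `…RatLiftAlgebra`)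

NOT a statement of any manuscript. Helper file of the chain res-L1-w45b (cell `res-hironaka`, rung L, slot W4.5(b));
OURS; AI-written, weaker than expert review; def-free, no `sorry`, standard axioms; filed
`--supports stmt-ResolutionOfSingularities-20148 --as helper` (counted 0, registers nothing).

SETTING (hypothesis shape (B) EXTRINSIC of part 1). `π : O ↠ k` a surjection of coefficient rings with `ker π` inside the
Jacobson radical (`O` local — `ker_le_jacobson_bot_of_isLocalRing`); `F : σ → O[x_τ]` forms of ONE degree `e` lifting
`f = π F`; `𝔓 := ker (aeval F)` upstairs, `𝔭 := ker (aeval f)` downstairs; the COFINITE CLAUSE at degree `m` downstairs is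
`𝒜_τ,k (e m) ≤ (𝒜_σ,k m).map (aeval f)` («every form of degree `e m` in the parameters is a form of degree `m` in the
`f i`» — for `τ = Fin 2` and all `m ≥ m₀`: the `f i` are base-point free and `ℙ¹_k → ℙⁿ_k` is a closed immersion onto
`Z = V₊(𝔭)`).

* `mem_ker_smul_homogeneousSubmodule_of_map_eq_zero` — a form killed by `π` lies in `(ker π) • 𝒜(d)`;
  `map_eq_zero_of_mem_ker_smul` — conversely `(ker π) • M` is killed by `π`;
* **`homogeneousSubmodule_le_map_aeval_of_map`** — NAKAYAMA LIFT OF THE CLAUSE: the clause at `m` downstairs gives the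
  clause at `m` upstairs, `𝒜_τ,O (e m) ≤ (𝒜_σ,O m).map (aeval F)` (Mathlib `Submodule.le_of_le_smul_of_le_jacobson_bot`
  with `I = ker π`, `N' = 𝒜_τ,O (e m)` finitely generated);
* **`exists_lift_mem_ker_aeval`** — THE EXACT TRACE, degreewise: under the clause at `m`, every `g ∈ 𝔭 ∩ k[x_σ]_m` is
  `π G` for some `G ∈ 𝔓 ∩ O[x_σ]_m` (lift `g` to `G₀`; `aeval F G₀ ∈ (ker π)•𝒜(e m) ≤ (ker π)•(aeval F)(𝒜 m)`, so
  `aeval F G₀ = aeval F G₁` with `G₁ ∈ (ker π)•𝒜(m)`; take `G = G₀ − G₁`); `mem_map_ker_aeval_of_mem` — hence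
  `𝔭_m ≤ (𝔓.map π)_m` (and `≥` is part 1's `map_ker_aeval_le`);
* **`X_pow_mul_mem_map_ker_aeval`** — if the clause holds for all `m ≥ m₀` (and `e ≥ 1`, so `𝔭` is homogeneous) then
  `X_i^{m₀} · 𝔭 ≤ 𝔓.map π ≤ 𝔭` for every `i`: the two homogeneous ideals differ by irrelevant torsion only;
* `ker_aeval_le_iff_map_ker_le` — so they lie in the same primes `𝔮 ∌ X_i` (same RELEVANT zero set, the `hSig`/support
  side of `projIdealSheaf`), and **`map_ker_aeval_eq_of_isUnit_X`** — they generate the SAME ideal in every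
  `k[x_σ]`-algebra in which some `X_i` is invertible (every affine chart / homogeneous localisation / stalk of `ℙⁿ_k`):
  the ring-level content of `(𝔓.map π)~ = 𝔭~ = 𝓘_Z`, to be combined by the `Proj` pen with part 1's generators
  (`exists_fin_isHomogeneous_span_eq_ker_aeval`), `map_span_range_eq` and res-D-pv-027's `CILift.comap_projIdealSheaf_span`.

* §3 (`τ = Fin 2`) **`clause_succ` / `clause_of_le`** — PROPAGATION: if `s^e, t^e` lie in the span of the `f i`, the
  cofinite clause in one degree `m₀ ≥ 1` implies it in all degrees `m ≥ m₀` (one finite check per specimen);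
  `homogeneousSubmodule_le_of_forall_monomial_mem`, `X_pow_mem_map_of_eq` (bookkeeping).

References: Nakayama's lemma [Matsumura1987, Thm. 2.2]; Stacks 00DV; folklore on kernels of parametrisations; cell:
PLANNER-MEMO-g10-1 (res-L1-w45b-plan-1; OURS, index only), `CILift.exists_homogeneous_lift` (res-D-pv-027, p522728).
-/

set_option linter.dupNamespace false -- mandated namespace `Summit.<Summit>.<Problem>` of this single-conjunct summit

namespace Summit.ResolutionOfSingularities.ResolutionOfSingularities.Cruxes.EquisingularLiftNat.Sections

namespace RatLift

open MvPolynomial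

universe u v w w'

/-! ## §1 Forms killed by `π` -/

section Killed

variable {O : Type u} {k : Type v} [CommRing O] [CommRing k] (π : O →+* k) {σ : Type w}

/-- **A form killed by `π` lies in `(ker π) • 𝒜(d)`**: all its coefficients are in `ker π` and its monomials are forms of
degree `d`. [folklore] [OURS · L1 W4.5b] -/
theorem mem_ker_smul_homogeneousSubmodule_of_map_eq_zero {d : ℕ} {P : MvPolynomial σ O}
    (hP : P ∈ homogeneousSubmodule σ O d) (h0 : MvPolynomial.map π P = 0) :
    P ∈ RingHom.ker π • homogeneousSubmodule σ O d := by
  classical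
  rw [as_sum P]
  refine Submodule.sum_mem _ fun s hs => ?_
  have hc : coeff s P ∈ RingHom.ker π := by
    rw [RingHom.mem_ker]
    have h := congrArg (coeff s) h0
    rwa [coeff_map, coeff_zero] at h
  have hdeg : s.degree = d := by
    rw [Finsupp.degree_eq_weight_one]
    exact hP (mem_support_iff.mp hs)
  have hmono : (monomial s (1 : O)) ∈ homogeneousSubmodule σ O d :=
    (mem_homogeneousSubmodule _ _).mpr (isHomogeneous_monomial _ hdeg)
  have e1 : coeff s P • monomial s (1 : O) = monomial s (coeff s P) := by
    rw [smul_monomial, smul_eq_mul, mul_one]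
  rw [← e1]
  exact Submodule.smul_mem_smul hc hmono

/-- Conversely, everything in `(ker π) • M` is killed by `π`. [folklore] [OURS · L1 W4.5b] -/
theorem map_eq_zero_of_mem_ker_smul {M : Submodule O (MvPolynomial σ O)} {G : MvPolynomial σ O}
    (hG : G ∈ RingHom.ker π • M) : MvPolynomial.map π G = 0 := by
  refine Submodule.smul_induction_on hG (fun r hr n _ => ?_) (fun x y hx hy => ?_)
  · rw [smul_eq_C_mul, map_mul, map_C, RingHom.mem_ker.mp hr, C_0, zero_mul]
  · rw [map_add, hx, hy, add_zero]

/-- Over a LOCAL ring `O`, the kernel of a homomorphism onto a non-trivial ring lies in the Jacobson radical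
(`ker π ≤ 𝔪_O = jacobson ⊥`) — the Nakayama hypothesis of this file, discharged. [folklore] [OURS · L1 W4.5b] -/
theorem ker_le_jacobson_bot_of_isLocalRing [IsLocalRing O] [Nontrivial k] :
    RingHom.ker π ≤ (⊥ : Ideal O).jacobson := by
  rw [IsLocalRing.jacobson_eq_maximalIdeal ⊥ bot_ne_top]
  exact IsLocalRing.le_maximalIdeal (RingHom.ker_ne_top π)

end Killed

/-! ## §2 Nakayama lift of the cofinite clause and the exact trace -/

section Trace

variable {O : Type u} {k : Type v} [CommRing O] [CommRing k] (π : O →+* k) (hπ : Function.Surjective π)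
  (hjac : RingHom.ker π ≤ (⊥ : Ideal O).jacobson) {σ : Type w} {τ : Type w'} [Finite τ]
  (F : σ → MvPolynomial τ O) (f : σ → MvPolynomial τ k) (hFf : ∀ i, MvPolynomial.map π (F i) = f i)
  {e : ℕ} (hF : ∀ i, (F i).IsHomogeneous e)

include hπ hjac hFf hF in
/-- **NAKAYAMA LIFT OF THE COFINITE CLAUSE.** If every form of degree `e m` over `k` is a form of degree `m` in the
`f i`, then every form of degree `e m` over `O` is a form of degree `m` in the `F i`:
`𝒜_τ,O (e m) ≤ (𝒜_σ,O m).map (aeval F)`. (`N' = 𝒜_τ,O (e m)` is finitely generated and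
`N' ≤ (aeval F)(𝒜 m) + (ker π) • N'` by lifting the downstairs representation; Nakayama.)
[cite: Matsumura1987, Thm. 2.2] [OURS · L1 W4.5b] -/
theorem homogeneousSubmodule_le_map_aeval_of_map (m : ℕ)
    (hcl : homogeneousSubmodule τ k (e * m) ≤ (homogeneousSubmodule σ k m).map (aeval (R := k) f).toLinearMap) :
    homogeneousSubmodule τ O (e * m) ≤ (homogeneousSubmodule σ O m).map (aeval (R := O) F).toLinearMap := by
  apply Submodule.le_of_le_smul_of_le_jacobson_bot (homogeneousSubmodule_fg _ _ _) hjac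
  intro H hH
  have hHk : MvPolynomial.map π H ∈ homogeneousSubmodule τ k (e * m) :=
    (mem_homogeneousSubmodule _ _).mpr (((mem_homogeneousSubmodule _ _).mp hH).map π)
  obtain ⟨g, hg, hgH⟩ := hcl hHk
  obtain ⟨G, hG, hGg⟩ := CILift.exists_homogeneous_lift π hπ g hg
  have h1 : aeval F G ∈ (homogeneousSubmodule σ O m).map (aeval (R := O) F).toLinearMap :=
    Submodule.mem_map_of_mem hG
  have h2 : H - aeval F G ∈ RingHom.ker π • homogeneousSubmodule τ O (e * m) := by
    apply mem_ker_smul_homogeneousSubmodule_of_map_eq_zero π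
    · exact Submodule.sub_mem _ hH (aeval_mem_homogeneousSubmodule F hF hG)
    · rw [AlgHom.toLinearMap_apply] at hgH
      rw [map_sub, map_aeval_eq π F f hFf, hGg, hgH, sub_self]
  have h3 := Submodule.add_mem_sup h1 h2
  rwa [add_sub_cancel] at h3

include hπ hjac hFf hF in
/-- **THE EXACT TRACE, DEGREEWISE.** Under the cofinite clause at degree `m`, every `g ∈ 𝔭 = ker (aeval f)` homogeneous of
degree `m` is the reduction of some `G ∈ 𝔓 = ker (aeval F)` homogeneous of degree `m`. [folklore; Nakayama]
[OURS · L1 W4.5b] -/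
theorem exists_lift_mem_ker_aeval {m : ℕ}
    (hcl : homogeneousSubmodule τ k (e * m) ≤ (homogeneousSubmodule σ k m).map (aeval (R := k) f).toLinearMap)
    {g : MvPolynomial σ k} (hg : g ∈ homogeneousSubmodule σ k m) (hgker : g ∈ RingHom.ker (aeval (R := k) f)) :
    ∃ G : MvPolynomial σ O, G ∈ homogeneousSubmodule σ O m ∧ G ∈ RingHom.ker (aeval (R := O) F) ∧
      MvPolynomial.map π G = g := by
  obtain ⟨G₀, hG₀, hG₀g⟩ := CILift.exists_homogeneous_lift π hπ g hg
  have hH : aeval F G₀ ∈ homogeneousSubmodule τ O (e * m) := aeval_mem_homogeneousSubmodule F hF hG₀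
  have hH0 : MvPolynomial.map π (aeval F G₀) = 0 := by
    rw [map_aeval_eq π F f hFf, hG₀g]
    exact RingHom.mem_ker.mp hgker
  have hH' : aeval F G₀ ∈ RingHom.ker π • (homogeneousSubmodule σ O m).map (aeval (R := O) F).toLinearMap :=
    Submodule.smul_mono le_rfl (homogeneousSubmodule_le_map_aeval_of_map π hπ hjac F f hFf hF m hcl)
      (mem_ker_smul_homogeneousSubmodule_of_map_eq_zero π hH hH0)
  rw [← Submodule.map_smul''] at hH'
  obtain ⟨G₁, hG₁, hG₁eq⟩ := hH'
  rw [AlgHom.toLinearMap_apply] at hG₁eq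
  refine ⟨G₀ - G₁, ?_, ?_, ?_⟩
  · exact Submodule.sub_mem _ hG₀ (Submodule.smul_le_right hG₁)
  · rw [RingHom.mem_ker, map_sub, hG₁eq, sub_self]
  · rw [map_sub, hG₀g, map_eq_zero_of_mem_ker_smul π hG₁, sub_zero]

include hπ hjac hFf hF in
/-- `𝔭_m ≤ (𝔓.map π)_m` under the clause at degree `m` (with part 1's `map_ker_aeval_le`: EQUALITY in degree `m`).
[folklore] [OURS · L1 W4.5b] -/
theorem mem_map_ker_aeval_of_mem {m : ℕ}
    (hcl : homogeneousSubmodule τ k (e * m) ≤ (homogeneousSubmodule σ k m).map (aeval (R := k) f).toLinearMap)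
    {g : MvPolynomial σ k} (hg : g ∈ homogeneousSubmodule σ k m) (hgker : g ∈ RingHom.ker (aeval (R := k) f)) :
    g ∈ (RingHom.ker (aeval (R := O) F)).map (MvPolynomial.map π) := by
  obtain ⟨G, -, hG, rfl⟩ := exists_lift_mem_ker_aeval π hπ hjac F f hFf hF hcl hg hgker
  exact Ideal.mem_map_of_mem _ hG

include hπ hjac hFf hF in
/-- **`X_i^{m₀} · 𝔭 ≤ 𝔓.map π`.** If `e ≥ 1` (so that `𝔭` is homogeneous) and the cofinite clause holds in all degrees
`m ≥ m₀`, then for every `g ∈ 𝔭` and every variable `X_i`, `X_i^{m₀} g ∈ 𝔓.map π`: the homogeneous ideals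
`𝔓.map π ≤ 𝔭` agree up to irrelevant torsion. [folklore] [OURS · L1 W4.5b] -/
theorem X_pow_mul_mem_map_ker_aeval (he : 0 < e) {m₀ : ℕ}
    (hcl : ∀ m, m₀ ≤ m →
      homogeneousSubmodule τ k (e * m) ≤ (homogeneousSubmodule σ k m).map (aeval (R := k) f).toLinearMap)
    {g : MvPolynomial σ k} (hgker : g ∈ RingHom.ker (aeval (R := k) f)) (i : σ) :
    X i ^ m₀ * g ∈ (RingHom.ker (aeval (R := O) F)).map (MvPolynomial.map π) := by
  classical
  letI := MvPolynomial.gradedAlgebra (σ := σ) (R := k)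
  have hf : ∀ i, (f i).IsHomogeneous e := isHomogeneous_of_map_eq π F f hFf hF
  have hhom := isHomogeneous_ker_aeval f hf he
  rw [← sum_homogeneousComponent g, Finset.mul_sum]
  refine Ideal.sum_mem _ fun d _ => ?_
  have hd : homogeneousComponent d g ∈ RingHom.ker (aeval (R := k) f) := homogeneousComponent_mem_of_mem hhom hgker d
  have hdeg : X i ^ m₀ * homogeneousComponent d g ∈ homogeneousSubmodule σ k (m₀ + d) :=
    (isHomogeneous_X_pow i m₀).mul (homogeneousComponent_isHomogeneous d g)
  exact mem_map_ker_aeval_of_mem π hπ hjac F f hFf hF (hcl (m₀ + d) (Nat.le_add_right _ _)) hdeg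
    (Ideal.mul_mem_left _ _ hd)

include hπ hjac hFf hF in
/-- **Same relevant primes.** Under the hypotheses of `X_pow_mul_mem_map_ker_aeval`, a prime `𝔮` of `k[x_σ]` missing some
variable `X_i` contains `𝔭` iff it contains `𝔓.map π` (the support / `hSig` side of `projIdealSheaf`). [folklore]
[OURS · L1 W4.5b] -/
theorem ker_aeval_le_iff_map_ker_le (he : 0 < e) {m₀ : ℕ}
    (hcl : ∀ m, m₀ ≤ m →
      homogeneousSubmodule τ k (e * m) ≤ (homogeneousSubmodule σ k m).map (aeval (R := k) f).toLinearMap)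
    {𝔮 : Ideal (MvPolynomial σ k)} [𝔮.IsPrime] {i : σ} (hi : X i ∉ 𝔮) :
    RingHom.ker (aeval (R := k) f) ≤ 𝔮 ↔ (RingHom.ker (aeval (R := O) F)).map (MvPolynomial.map π) ≤ 𝔮 := by
  constructor
  · exact fun h => (map_ker_aeval_le π F f hFf).trans h
  · intro h g hg
    have hX := h (X_pow_mul_mem_map_ker_aeval π hπ hjac F f hFf hF he hcl hg i)
    exact ((Ideal.IsPrime.mem_or_mem ‹_› hX).resolve_left fun hX' => hi (Ideal.IsPrime.mem_of_pow_mem ‹_› _ hX'))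

include hπ hjac hFf hF in
/-- Elementwise membership form of `ker_aeval_le_iff_map_ker_le` with the named generators: for a prime `𝔮 ∌ X_i` and
any family `G` spanning `𝔓`, `(∀ j, π (G j) ∈ 𝔮) ↔ 𝔭 ≤ 𝔮` — the zero set of the reduced generators is `V₊(𝔭)` on the
chart `X_i ≠ 0`. [folklore] [OURS · L1 W4.5b] -/
theorem forall_map_mem_iff_ker_aeval_le (he : 0 < e) {m₀ : ℕ}
    (hcl : ∀ m, m₀ ≤ m →
      homogeneousSubmodule τ k (e * m) ≤ (homogeneousSubmodule σ k m).map (aeval (R := k) f).toLinearMap)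
    {N : ℕ} {G : Fin N → MvPolynomial σ O} (hG : Ideal.span (Set.range G) = RingHom.ker (aeval (R := O) F))
    {𝔮 : Ideal (MvPolynomial σ k)} [𝔮.IsPrime] {i : σ} (hi : X i ∉ 𝔮) :
    (∀ j, MvPolynomial.map π (G j) ∈ 𝔮) ↔ RingHom.ker (aeval (R := k) f) ≤ 𝔮 := by
  rw [ker_aeval_le_iff_map_ker_le π hπ hjac F f hFf hF he hcl hi, ← hG, map_span_range_eq π, Ideal.span_le,
    Set.range_subset_iff]
  rfl

include hπ hjac hFf hF in
/-- **Same ideal wherever a variable is inverted.** Under the hypotheses of `X_pow_mul_mem_map_ker_aeval`, in every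
`k[x_σ]`-algebra `B` in which some `X_i` is a unit (affine charts `D₊(x_i)`, homogeneous localisations, stalks of `ℙⁿ_k`)
the extensions of `𝔭` and of `𝔓.map π` coincide. This is the ring-level content of `(𝔓.map π)~ = 𝔭~`.
[folklore] [OURS · L1 W4.5b] -/
theorem map_ker_aeval_eq_of_isUnit_X (he : 0 < e) {m₀ : ℕ}
    (hcl : ∀ m, m₀ ≤ m →
      homogeneousSubmodule τ k (e * m) ≤ (homogeneousSubmodule σ k m).map (aeval (R := k) f).toLinearMap)
    {B : Type*} [CommRing B] [Algebra (MvPolynomial σ k) B] {i : σ} (hi : IsUnit (algebraMap (MvPolynomial σ k) B (X i))) :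
    (RingHom.ker (aeval (R := k) f)).map (algebraMap (MvPolynomial σ k) B) =
      ((RingHom.ker (aeval (R := O) F)).map (MvPolynomial.map π)).map (algebraMap (MvPolynomial σ k) B) := by
  refine le_antisymm ?_ (Ideal.map_mono (map_ker_aeval_le π F f hFf))
  rw [Ideal.map_le_iff_le_comap]
  intro g hg
  rw [Ideal.mem_comap]
  have h1 : algebraMap (MvPolynomial σ k) B (X i ^ m₀ * g) ∈
      ((RingHom.ker (aeval (R := O) F)).map (MvPolynomial.map π)).map (algebraMap (MvPolynomial σ k) B) :=
    Ideal.mem_map_of_mem _ (X_pow_mul_mem_map_ker_aeval π hπ hjac F f hFf hF he hcl hg i)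
  rw [map_mul, map_pow] at h1
  exact (Ideal.unit_mul_mem_iff_mem _ (hi.pow m₀)).mp h1

end Trace

/-! ## §3 Propagating the cofinite clause in the parameters `ℙ¹` (`τ = Fin 2`) -/

section Propagate

variable {k : Type v} [CommRing k] {σ : Type w}

/-- A submodule containing every monomial of degree `N` contains `𝒜 N`. [folklore] [OURS · L1 W4.5b] -/
theorem homogeneousSubmodule_le_of_forall_monomial_mem {τ' : Type w'} {N : ℕ} {M : Submodule k (MvPolynomial τ' k)}
    (h : ∀ d : τ' →₀ ℕ, d.degree = N → monomial d (1 : k) ∈ M) :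
    homogeneousSubmodule τ' k N ≤ M := by
  classical
  intro P hP
  rw [as_sum P]
  refine Submodule.sum_mem _ fun d hd => ?_
  have hdeg : d.degree = N := by
    rw [Finsupp.degree_eq_weight_one]
    exact hP (mem_support_iff.mp hd)
  have e1 : coeff d P • monomial d (1 : k) = monomial d (coeff d P) := by
    rw [smul_monomial, smul_eq_mul, mul_one]
  rw [← e1]
  exact M.smul_mem _ (h d hdeg)

variable (f : σ → MvPolynomial (Fin 2) k) {e : ℕ}

/-- **PROPAGATION OF THE COFINITE CLAUSE, one step.** Parameters `ℙ¹` (`τ = Fin 2`, variables `s = X 0`, `t = X 1`):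
if the pure powers `s^e` and `t^e` are linear combinations of the `f i` and the clause holds in degree `m ≥ 1`, it holds
in degree `m + 1` (every monomial of degree `e (m+1)` is `s^e ·` or `t^e ·` a monomial of degree `e m`). [folklore]
[OURS · L1 W4.5b] -/
theorem clause_succ (hs : X 0 ^ e ∈ (homogeneousSubmodule σ k 1).map (aeval (R := k) f).toLinearMap)
    (ht : X 1 ^ e ∈ (homogeneousSubmodule σ k 1).map (aeval (R := k) f).toLinearMap) {m : ℕ} (hm : 1 ≤ m)
    (hcl : homogeneousSubmodule (Fin 2) k (e * m) ≤ (homogeneousSubmodule σ k m).map (aeval (R := k) f).toLinearMap) :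
    homogeneousSubmodule (Fin 2) k (e * (m + 1)) ≤
      (homogeneousSubmodule σ k (m + 1)).map (aeval (R := k) f).toLinearMap := by
  classical
  apply homogeneousSubmodule_le_of_forall_monomial_mem
  intro d hd
  have hsum : d 0 + d 1 = e * m + e := by
    have h1 := Finsupp.degree_eq_sum d
    rw [hd, Fin.sum_univ_two, mul_add, mul_one] at h1
    exact h1.symm
  have hem : e ≤ e * m := Nat.le_mul_of_pos_right e hm
  suffices key : ∀ j : Fin 2, e ≤ d j → X j ^ e ∈ (homogeneousSubmodule σ k 1).map (aeval (R := k) f).toLinearMap →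
      monomial d (1 : k) ∈ (homogeneousSubmodule σ k (m + 1)).map (aeval (R := k) f).toLinearMap by
    rcases le_or_gt e (d 0) with h0 | h0
    · exact key 0 h0 hs
    · exact key 1 (by omega) ht
  intro j hj hXj
  obtain ⟨ℓ, hℓ, hℓeq⟩ := hXj
  set d' := d - Finsupp.single j e with hd'
  have hdd' : Finsupp.single j e + d' = d := add_tsub_cancel_of_le (Finsupp.single_le_iff.mpr hj)
  have hdeg' : d'.degree = e * m := by
    have h1 := congrArg Finsupp.degree hdd'
    rw [map_add, Finsupp.degree_single, hd, mul_add, mul_one] at h1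
    omega
  have hmono' : monomial d' (1 : k) ∈ homogeneousSubmodule (Fin 2) k (e * m) :=
    (mem_homogeneousSubmodule _ _).mpr (isHomogeneous_monomial _ hdeg')
  obtain ⟨g, hg, hgeq⟩ := hcl hmono'
  refine ⟨ℓ * g, ?_, ?_⟩
  · have h2 := homogeneousSubmodule_mul 1 m (Submodule.mul_mem_mul hℓ hg)
    rwa [add_comm] at h2
  · rw [AlgHom.toLinearMap_apply] at hℓeq hgeq ⊢
    rw [map_mul, hℓeq, hgeq, ← hdd', X_pow_eq_monomial, monomial_mul, mul_one]

/-- **PROPAGATION OF THE COFINITE CLAUSE to all larger degrees** (`τ = Fin 2`; `s^e`, `t^e` in the span of the `f i`):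
the clause in ONE degree `m₀ ≥ 1` gives it in every degree `m ≥ m₀` — so for plane-parametrised specimens
(rational normal curves, the smooth rational quartic `(s⁴ : s³t : st³ : t⁴)`, …) one finite-dimensional check suffices.
[folklore] [OURS · L1 W4.5b] -/
theorem clause_of_le (hs : X 0 ^ e ∈ (homogeneousSubmodule σ k 1).map (aeval (R := k) f).toLinearMap)
    (ht : X 1 ^ e ∈ (homogeneousSubmodule σ k 1).map (aeval (R := k) f).toLinearMap) {m₀ : ℕ} (hm₀ : 1 ≤ m₀)
    (hcl : homogeneousSubmodule (Fin 2) k (e * m₀) ≤ (homogeneousSubmodule σ k m₀).map (aeval (R := k) f).toLinearMap) :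
    ∀ m, m₀ ≤ m →
      homogeneousSubmodule (Fin 2) k (e * m) ≤ (homogeneousSubmodule σ k m).map (aeval (R := k) f).toLinearMap := by
  intro m hm
  induction m, hm using Nat.le_induction with
  | base => exact hcl
  | succ m hm ih => exact clause_succ f hs ht (le_trans hm₀ hm) ih

/-- If `f i₀ = s^e` literally, then `s^e` is in the span of the `f i` (the form in which `clause_succ` wants it); same
for `t^e`. [folklore] [OURS · L1 W4.5b] -/
theorem X_pow_mem_map_of_eq {j : Fin 2} {i₀ : σ} (h : f i₀ = X j ^ e) :
    X j ^ e ∈ (homogeneousSubmodule σ k 1).map (aeval (R := k) f).toLinearMap := by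
  refine ⟨X i₀, (mem_homogeneousSubmodule _ _).mpr (isHomogeneous_X k i₀), ?_⟩
  rw [AlgHom.toLinearMap_apply, aeval_X, h]

end Propagate

end RatLift

end Summit.ResolutionOfSingularities.ResolutionOfSingularities.Cruxes.EquisingularLiftNat.Sections
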